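import Literature.Topology.Immersions.ProjectionFieldBundle
import Literature.Topology.Immersions.HirschImmersionParallelizableProduct
import HarnessLib

/-!
# Hirsch's immersion theorem with prescribed normal bundle (from Phillips' theorem)

Topic `Literature/Topology/Immersions`. M. W. Hirsch, *Immersions of manifolds*, Trans. Amer.
Math. Soc. 93 (1959), Thm. 6.3 ff. (cf. Kirby, *The Topology of 4-Manifolds* (1989), Ch. VI,
proof of Lemma 1: "an immersion `M⁴ ↬ ℝ⁶` with normal bundle `ν` exists iff `τ_M ⊕ ν` is
trivial", citing Hirsch): if `E → M` is a rank-`k` vector bundle (`k ≥ 1`) with `TM ⊕ E` trivial,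
then the `n`-manifold `M` immerses in `ℝⁿ⁺ᵏ` with normal bundle `E`.

We prove it from the tree's (discharged) Phillips theorem
`Literature.Topology.Immersions.Phillips1967_exists_isLocalDiffeomorph_of_isParallelizable_holds`
applied to the **total space** `E(P)` of the bundle, realised as in
`ProjectionFieldBundle.lean` by a smooth field of orthogonal projections `P` on `M × ℝᵐ`:

* `ProjBundle.isParallelizable_total_of_frame` — a framing of `TM ⊕ E` (`n + k` continuous
  sections `x ↦ (Xᵢ x, Wᵢ x) ∈ T_x M × E_x`, pointwise independent) parallelizes `E(P)`: the lifted
  fields `d(retr)(Xᵢ, Wᵢ)` frame `T E(P)` (`retr (y, w) = (y, P_y w)` is the smooth retraction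
  `M × ℝᵐ → E(P)`; `d(base) ∘ d(retr) = pr₁` and `d(vec) ∘ d(retr) (0, W) = P_x W` show the lifts stay
  independent);
* `ProjBundle.not_isCompact_connectedComponent` — `E(P)` is an open manifold (`k ≥ 1`);
* `ProjBundle.exists_immersion_of_isParallelizable_total` — **Hirsch**: if `E(P)` is
  parallelizable there is a `C^∞` map `F : M × ℝᵐ → ℝⁿ⁺ᵏ` (a local diffeomorphism of `E(P)`
  composed with `retr`) whose differential at `(x, v)` kills `(X, W)` only if `X = 0` and
  `P_x W = 0`; in particular (`ProjBundle.exists_immersion_of_frame`) `g = F(·, 0)` is an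
  immersion `M ↬ ℝⁿ⁺ᵏ`, `dg_x X = dF_{(x,0)}(X, 0)`, and `w ↦ dF_{(x,0)}(0, w)` maps `E_x`
  isomorphically onto a complement of `dg(T_x M)` — the normal bundle of `g` **is** `E`.

Everything here is proved; no named facts are introduced (D-0026).

## References

* M. W. Hirsch, *Immersions of manifolds*, Trans. Amer. Math. Soc. 93 (1959), 242–276, §6
  (Thm. 6.3). [Hirsch1959]
* A. Phillips, *Submersions of open manifolds*, Topology 6 (1967), 171–206, Cor. 8.2. [Phillips1967]
* R. C. Kirby, *The Topology of 4-Manifolds*, LNM 1374 (1989), Ch. VI, Lemma 1. [Kirby1989]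
-/

open scoped Manifold ContDiff Topology
open Set Function Module Bundle

noncomputable section

namespace Literature.Topology.Immersions

/-- Local notation: `𝔼 n` is the model Euclidean space `EuclideanSpace ℝ (Fin n)`. -/
local notation "𝔼 " n:arg => EuclideanSpace ℝ (Fin n)

open Literature.Topology.FourManifolds (IsParallelizable)

namespace ProjBundle

variable {n m k : ℕ}

section Lift

variable {M : Type*} [TopologicalSpace M] [ChartedSpace (𝔼 n) M] [IsManifold (𝓡 n) ∞ M]
  (P : ProjBundle n m k M)

/-! ### Differential of the retraction -/

/-- **`d(base) ∘ d(retr)_q = pr₁`**: the base component of a lifted vector. [folklore] -/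
theorem mfderiv_base_mfderiv_retr (q : M × 𝔼 m) (S : 𝔼 n × 𝔼 m) :
    mfderiv 𝓘(ℝ, 𝔼 n × 𝔼 k) (𝓡 n) P.base (P.retr q)
      (mfderiv ((𝓡 n).prod (𝓡 m)) 𝓘(ℝ, 𝔼 n × 𝔼 k) P.retr q S) = S.1 := by
  have hbase : MDifferentiableAt 𝓘(ℝ, 𝔼 n × 𝔼 k) (𝓡 n) P.base (P.retr q) :=
    (P.contMDiff_base _).mdifferentiableAt (by simp)
  have hr : MDifferentiableAt ((𝓡 n).prod (𝓡 m)) 𝓘(ℝ, 𝔼 n × 𝔼 k) P.retr q :=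
    (P.contMDiff_retr _).mdifferentiableAt (by simp)
  have h := mfderiv_comp q hbase hr
  have hfst : P.base ∘ P.retr = Prod.fst := rfl
  rw [hfst, mfderiv_fst] at h
  exact (DFunLike.congr_fun h S).symm

/-- **`d(vec) ∘ d(retr)_{(x,v)} (0, W) = P_x W`**: the fibre component of a vertical lift
(`vec ∘ retr ∘ (x, ·) = P_x` is linear). [folklore] -/
theorem mfderiv_vec_mfderiv_retr_inr (x : M) (v W : 𝔼 m) :
    mfderiv 𝓘(ℝ, 𝔼 n × 𝔼 k) (𝓡 m) P.vec (P.retr (x, v))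
      (mfderiv ((𝓡 n).prod (𝓡 m)) 𝓘(ℝ, 𝔼 n × 𝔼 k) P.retr (x, v) ((0 : 𝔼 n), W)) = P.proj x W := by
  have hι : ContMDiff (𝓡 m) ((𝓡 n).prod (𝓡 m)) ∞ fun w : 𝔼 m => (x, w) :=
    contMDiff_const.prodMk contMDiff_id
  have hιd : MDifferentiableAt (𝓡 m) ((𝓡 n).prod (𝓡 m)) (fun w : 𝔼 m => (x, w)) v :=
    (hι v).mdifferentiableAt (by simp)
  have hr : MDifferentiableAt ((𝓡 n).prod (𝓡 m)) 𝓘(ℝ, 𝔼 n × 𝔼 k) P.retr (x, v) :=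
    (P.contMDiff_retr _).mdifferentiableAt (by simp)
  have hvec : MDifferentiableAt 𝓘(ℝ, 𝔼 n × 𝔼 k) (𝓡 m) P.vec (P.retr (x, v)) :=
    (P.contMDiff_vec _).mdifferentiableAt (by simp)
  have h0 : ((0 : 𝔼 n), W) = mfderiv (𝓡 m) ((𝓡 n).prod (𝓡 m)) (fun w : 𝔼 m => (x, w)) v W := by
    rw [mfderiv_prod_right]; rfl
  have h1 : mfderiv (𝓡 m) 𝓘(ℝ, 𝔼 n × 𝔼 k) (P.retr ∘ fun w : 𝔼 m => (x, w)) v =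
      (mfderiv ((𝓡 n).prod (𝓡 m)) 𝓘(ℝ, 𝔼 n × 𝔼 k) P.retr (x, v)).comp
        (mfderiv (𝓡 m) ((𝓡 n).prod (𝓡 m)) (fun w : 𝔼 m => (x, w)) v) := mfderiv_comp v hr hιd
  have h2 : mfderiv (𝓡 m) (𝓡 m) (P.vec ∘ (P.retr ∘ fun w : 𝔼 m => (x, w))) v =
      (mfderiv 𝓘(ℝ, 𝔼 n × 𝔼 k) (𝓡 m) P.vec (P.retr (x, v))).comp
        (mfderiv (𝓡 m) 𝓘(ℝ, 𝔼 n × 𝔼 k) (P.retr ∘ fun w : 𝔼 m => (x, w)) v) :=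
    mfderiv_comp v hvec (hr.comp v hιd)
  have h3 : P.vec ∘ (P.retr ∘ fun w : 𝔼 m => (x, w)) = ⇑(P.proj x) := rfl
  rw [h3, ContinuousLinearMap.mfderiv_eq, h1] at h2
  rw [h0]
  exact (DFunLike.congr_fun h2 W).symm

/-- **A lifted vector `d(retr)_{(x,v)} (X, W)` vanishes only if `X = 0` and `P_x W = 0`.**
[folklore] -/
theorem eq_zero_of_mfderiv_retr_eq_zero (x : M) (v : 𝔼 m) (S : 𝔼 n × 𝔼 m)
    (h : mfderiv ((𝓡 n).prod (𝓡 m)) 𝓘(ℝ, 𝔼 n × 𝔼 k) P.retr (x, v) S = 0) :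
    S.1 = 0 ∧ P.proj x S.2 = 0 := by
  have h1 : S.1 = 0 := by
    have := P.mfderiv_base_mfderiv_retr (x, v) S
    rw [h, map_zero] at this
    exact this.symm
  refine ⟨h1, ?_⟩
  have hS : S = ((0 : 𝔼 n), S.2) := Prod.ext h1 rfl
  have := P.mfderiv_vec_mfderiv_retr_inr x v S.2
  rw [← hS, h, map_zero] at this
  exact this.symm

/-! ### Parallelizations of the total space from framings of `TM ⊕ E` -/

/-- The **lift** `(X, W) ↦ d(retr)_{incl p} (X, W) : T_{base p} M × ℝᵐ →L T_p E(P)`, as a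
continuous linear map `ℝⁿ × ℝᵐ →L ℝⁿ × ℝᵏ`. [folklore] -/
def liftCLM (p : P.Total) : (𝔼 n × 𝔼 m) →L[ℝ] (𝔼 n × 𝔼 k) :=
  mfderiv ((𝓡 n).prod (𝓡 m)) 𝓘(ℝ, 𝔼 n × 𝔼 k) P.retr (P.incl p)

omit [IsManifold (𝓡 n) ∞ M] in
/-- The lift, as a point of the tangent bundle, is the tangent map of `retr`. [folklore] -/
theorem totalSpaceMk_liftCLM (p : P.Total) (S : 𝔼 n × 𝔼 m) :
    (TotalSpace.mk' (𝔼 n × 𝔼 k) p (P.liftCLM p S) : TangentBundle 𝓘(ℝ, 𝔼 n × 𝔼 k) P.Total) =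
      tangentMap ((𝓡 n).prod (𝓡 m)) 𝓘(ℝ, 𝔼 n × 𝔼 k) P.retr
        (TotalSpace.mk' (𝔼 n × 𝔼 m) (P.incl p) S :
          TangentBundle ((𝓡 n).prod (𝓡 m)) (M × 𝔼 m)) :=
  TotalSpace.ext (P.retr_incl p).symm HEq.rfl

/-- **A framing of `TM ⊕ E` parallelizes the total space `E(P)`** (Hirsch's reduction of
"immersion with normal bundle `E`" to "`TM ⊕ E` trivial"): given `n + k` sections
`x ↦ (Xᵢ x, Wᵢ x)` with `Xᵢ` continuous vector fields on `M`, `Wᵢ : M → ℝᵐ` continuous with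
`Wᵢ x ∈ E_x`, and `(Xᵢ x, Wᵢ x)ᵢ` linearly independent at every `x`, the lifts
`p ↦ d(retr)_{incl p} (Xᵢ (base p), Wᵢ (base p))` frame `T E(P)`. [cite: Hirsch1959, Thm. 6.3] -/
theorem isParallelizable_total_of_frame (s : Fin (n + k) → M → 𝔼 n × 𝔼 m)
    (hs1 : ∀ i, Continuous fun x => (TotalSpace.mk' (𝔼 n) x (s i x).1 : TangentBundle (𝓡 n) M))
    (hs2 : ∀ i, Continuous fun x => (s i x).2)
    (hs3 : ∀ i x, P.proj x (s i x).2 = (s i x).2)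
    (hli : ∀ x, LinearIndependent ℝ fun i => s i x) :
    IsParallelizable 𝓘(ℝ, 𝔼 n × 𝔼 k) P.Total := by
  have hrank : finrank ℝ (𝔼 n × 𝔼 k) = n + k := by simp [Module.finrank_prod]
  let e : Fin (finrank ℝ (𝔼 n × 𝔼 k)) ≃ Fin (n + k) := finCongr hrank
  refine ⟨fun i p => P.liftCLM p (s (e i) (P.base p)), fun i => ?_, fun p => ?_⟩
  · -- continuity: `⟨p, lift S⟩ = tangentMap retr ⟨incl p, S⟩`
    have hA : Continuous fun p : P.Total =>
        (TotalSpace.mk' (𝔼 n) (P.base p) (s (e i) (P.base p)).1 : TangentBundle (𝓡 n) M) :=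
      (hs1 (e i)).comp P.continuous_base
    have hB : Continuous fun p : P.Total =>
        (TotalSpace.mk' (𝔼 m) (P.vec p) (s (e i) (P.base p)).2 : TangentBundle (𝓡 m) (𝔼 m)) := by
      have hh := (tangentBundleModelSpaceHomeomorph (I := 𝓡 m) (H := 𝔼 m)).symm.continuous
      have hdata : Continuous fun p : P.Total =>
          ((P.vec p, (s (e i) (P.base p)).2) : ModelProd (𝔼 m) (𝔼 m)) :=
        P.continuous_vec.prodMk ((hs2 (e i)).comp P.continuous_base)
      exact hh.comp hdata
    have hC := (contMDiff_equivTangentBundleProd_symm (n := 0) (I := 𝓡 n) (M := M) (I' := 𝓡 m)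
      (M' := 𝔼 m)).continuous
    have hV : Continuous fun p : P.Total => (TotalSpace.mk' (𝔼 n × 𝔼 m) (P.incl p)
        (s (e i) (P.base p)) : TangentBundle ((𝓡 n).prod (𝓡 m)) (M × 𝔼 m)) :=
      hC.comp (hA.prodMk hB)
    have hT : Continuous (tangentMap ((𝓡 n).prod (𝓡 m)) 𝓘(ℝ, 𝔼 n × 𝔼 k) P.retr) :=
      P.contMDiff_retr.continuous_tangentMap (by simp)
    exact (hT.comp hV).congr fun p => (P.totalSpaceMk_liftCLM p _).symm
  · -- pointwise linear independence
    have hli' : LinearIndependent ℝ fun i => s (e i) (P.base p) := (hli (P.base p)).comp e e.injective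
    rw [Fintype.linearIndependent_iff] at hli' ⊢
    intro c hc
    have hsum : P.liftCLM p (∑ i, c i • s (e i) (P.base p)) = 0 := by
      rw [map_sum]
      simp_rw [map_smul]
      exact hc
    have h0 := P.eq_zero_of_mfderiv_retr_eq_zero (P.base p) (P.vec p) _ hsum
    have hS2 : P.proj (P.base p) (∑ i, c i • s (e i) (P.base p)).2 = (∑ i, c i • s (e i) (P.base p)).2 := by
      simp only [Prod.snd_sum, Prod.smul_snd, map_sum, map_smul, hs3]
    have hS0 : ∑ i, c i • s (e i) (P.base p) = 0 := Prod.ext h0.1 (by rw [← hS2]; exact h0.2)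
    exact hli' c hS0

/-! ### The total space is an open manifold -/

omit [IsManifold (𝓡 n) ∞ M] in
/-- **No component of `E(P)` is compact when `k ≥ 1`**: the fibre over `x = base p` is a closed
connected subset of the component of `p` on which `vec` is unbounded. [folklore] -/
theorem not_isCompact_connectedComponent [T1Space M] (hk : 1 ≤ k) (p : P.Total) :
    ¬IsCompact (connectedComponent p) := by
  intro hc
  have hsub : range (fun w : 𝔼 m => P.retr (P.base p, w)) ⊆ connectedComponent p := by
    have hconn : IsConnected (range fun w : 𝔼 m => P.retr (P.base p, w)) :=
      isConnected_range (P.continuous_retr.comp (continuous_const.prodMk continuous_id))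
    have hp : p ∈ range fun w : 𝔼 m => P.retr (P.base p, w) := ⟨P.vec p, P.retr_incl p⟩
    exact hconn.2.subset_connectedComponent hp
  have hclosed : IsClosed (range fun w : 𝔼 m => P.retr (P.base p, w)) := by
    have : range (fun w : 𝔼 m => P.retr (P.base p, w)) = P.base ⁻¹' {P.base p} := by
      ext q
      constructor
      · rintro ⟨w, rfl⟩
        rfl
      · intro hq
        have hq' : P.base q = P.base p := hq
        exact ⟨P.vec q, by rw [← hq']; exact P.retr_incl q⟩
    rw [this]
    exact isClosed_singleton.preimage P.continuous_base
  have hK : IsCompact (P.vec '' range fun w : 𝔼 m => P.retr (P.base p, w)) :=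
    (hc.of_isClosed_subset hclosed hsub).image P.continuous_vec
  obtain ⟨C, hC0, hC⟩ := hK.isBounded.exists_pos_norm_le
  -- a nonzero vector of the fibre
  have hpos : 0 < finrank ℝ (P.fibre (P.base p)) := by
    rw [show finrank ℝ (P.fibre (P.base p)) = k from P.finrank_range (P.base p)]
    exact hk
  obtain ⟨⟨v, hv⟩, hv0⟩ := Module.finrank_pos_iff_exists_ne_zero.1 hpos
  have hv0' : v ≠ 0 := fun h => hv0 (Subtype.ext h)
  have hvfix : P.proj (P.base p) v = v := P.mem_fibre_iff.1 hv
  have hmem : ∀ t : ℝ, t • v ∈ P.vec '' range fun w : 𝔼 m => P.retr (P.base p, w) := fun t =>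
    ⟨P.retr (P.base p, t • v), ⟨t • v, rfl⟩, by rw [vec_retr, map_smul, hvfix]⟩
  have hle := hC _ (hmem ((C + 1) / ‖v‖))
  have hvpos : 0 < ‖v‖ := norm_pos_iff.2 hv0'
  rw [norm_smul, Real.norm_eq_abs, abs_of_pos (by positivity), div_mul_cancel₀ _ hvpos.ne'] at hle
  linarith

end Lift

/-! ### Hirsch's theorem -/

/-- **Hirsch's immersion theorem with prescribed normal bundle, from Phillips' theorem.** Let
`E → M` be a rank-`k ≥ 1` bundle inside `M × ℝᵐ` (`P : ProjBundle n m k M`) over an `n`-manifold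
`M` (Hausdorff, second countable) whose total space `E(P)` is parallelizable — e.g. because
`TM ⊕ E` is framed (`isParallelizable_total_of_frame`). Then there is a `C^∞` map
`F : M × ℝᵐ → ℝⁿ⁺ᵏ` whose differential at every `(x, v)` annihilates `(X, W) ∈ T_x M × ℝᵐ` only
if `X = 0` and `P_x W = 0`: `F` is Phillips' local diffeomorphism `E(P) → ℝⁿ⁺ᵏ` of the open
parallelizable manifold `E(P)` (re-charted on `ℝⁿ⁺ᵏ`) composed with the retraction
`(y, w) ↦ (y, P_y w)`. [cite: Hirsch1959, Thm. 6.3; Phillips1967, Cor. 8.2] -/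
theorem exists_immersion_of_isParallelizable_total (hk : 1 ≤ k) {M : Type} [TopologicalSpace M]
    [T2Space M] [SecondCountableTopology M] [ChartedSpace (𝔼 n) M] [IsManifold (𝓡 n) ∞ M]
    (P : ProjBundle n m k M) (h : IsParallelizable 𝓘(ℝ, 𝔼 n × 𝔼 k) P.Total) :
    ∃ F : M × 𝔼 m → 𝔼 (n + k), ContMDiff ((𝓡 n).prod (𝓡 m)) (𝓡 (n + k)) ∞ F ∧
      ∀ (x : M) (v : 𝔼 m) (S : 𝔼 n × 𝔼 m),
        mfderiv ((𝓡 n).prod (𝓡 m)) (𝓡 (n + k)) F (x, v) S = 0 → S.1 = 0 ∧ P.proj x S.2 = 0 := by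
  -- `E(P)` re-charted on `ℝⁿ⁺ᵏ`: an open parallelizable `(n + k)`-manifold
  have hpar : IsParallelizable (𝓡 (n + k))
      (Remodel 𝓘(ℝ, 𝔼 n × 𝔼 k) (prodModelLin n k) P.Total) :=
    Remodel.isParallelizable_remodel 𝓘(ℝ, 𝔼 n × 𝔼 k) (prodModelLin n k) h
  have hopen : ∀ q : Remodel 𝓘(ℝ, 𝔼 n × 𝔼 k) (prodModelLin n k) P.Total,
      ¬IsCompact (connectedComponent q) := fun q => P.not_isCompact_connectedComponent hk q
  obtain ⟨G, hG⟩ := Phillips1967_exists_isLocalDiffeomorph_of_isParallelizable_holds (n + k)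
    (Remodel 𝓘(ℝ, 𝔼 n × 𝔼 k) (prodModelLin n k) P.Total) hopen hpar
  have hGs : ContMDiff (𝓡 (n + k)) (𝓡 (n + k)) ∞ G := hG.contMDiff
  have hTs := Remodel.contMDiff_toRemodel 𝓘(ℝ, 𝔼 n × 𝔼 k) (prodModelLin n k) (M := P.Total)
    (n := ∞)
  refine ⟨G ∘ Remodel.toRemodel 𝓘(ℝ, 𝔼 n × 𝔼 k) (prodModelLin n k) P.Total ∘ P.retr,
    hGs.comp (hTs.comp P.contMDiff_retr), fun x v S hS => ?_⟩
  apply P.eq_zero_of_mfderiv_retr_eq_zero x v S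
  have hrd : MDifferentiableAt ((𝓡 n).prod (𝓡 m)) 𝓘(ℝ, 𝔼 n × 𝔼 k) P.retr (x, v) :=
    (P.contMDiff_retr _).mdifferentiableAt (by simp)
  have hTd : MDifferentiableAt 𝓘(ℝ, 𝔼 n × 𝔼 k) (𝓡 (n + k))
      (Remodel.toRemodel 𝓘(ℝ, 𝔼 n × 𝔼 k) (prodModelLin n k) P.Total) (P.retr (x, v)) :=
    (hTs _).mdifferentiableAt (by simp)
  have hGd : MDifferentiableAt (𝓡 (n + k)) (𝓡 (n + k)) G
      (Remodel.toRemodel 𝓘(ℝ, 𝔼 n × 𝔼 k) (prodModelLin n k) P.Total (P.retr (x, v))) :=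
    (hGs _).mdifferentiableAt (by simp)
  rw [mfderiv_comp (x, v) (g := G)
      (f := Remodel.toRemodel 𝓘(ℝ, 𝔼 n × 𝔼 k) (prodModelLin n k) P.Total ∘ P.retr) hGd
      (hTd.comp (x, v) hrd),
    mfderiv_comp (x, v) (g := Remodel.toRemodel 𝓘(ℝ, 𝔼 n × 𝔼 k) (prodModelLin n k) P.Total)
      (f := P.retr) hTd hrd] at hS
  have hinjG : Injective (mfderiv (𝓡 (n + k)) (𝓡 (n + k)) G
      (Remodel.toRemodel 𝓘(ℝ, 𝔼 n × 𝔼 k) (prodModelLin n k) P.Total (P.retr (x, v)))) :=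
    ((hG _).mfderivToContinuousLinearEquiv (by simp)).injective
  have hinjT : Injective (mfderiv 𝓘(ℝ, 𝔼 n × 𝔼 k) (𝓡 (n + k))
      (Remodel.toRemodel 𝓘(ℝ, 𝔼 n × 𝔼 k) (prodModelLin n k) P.Total) (P.retr (x, v))) :=
    (Remodel.bijective_mfderiv_toRemodel 𝓘(ℝ, 𝔼 n × 𝔼 k) (prodModelLin n k) (n := ∞) (by simp)
      (P.retr (x, v))).1
  have hS' : mfderiv (𝓡 (n + k)) (𝓡 (n + k)) G
      (Remodel.toRemodel 𝓘(ℝ, 𝔼 n × 𝔼 k) (prodModelLin n k) P.Total (P.retr (x, v)))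
      (mfderiv 𝓘(ℝ, 𝔼 n × 𝔼 k) (𝓡 (n + k))
        (Remodel.toRemodel 𝓘(ℝ, 𝔼 n × 𝔼 k) (prodModelLin n k) P.Total) (P.retr (x, v))
        (mfderiv ((𝓡 n).prod (𝓡 m)) 𝓘(ℝ, 𝔼 n × 𝔼 k) P.retr (x, v) S)) = 0 := hS
  have h1 : mfderiv 𝓘(ℝ, 𝔼 n × 𝔼 k) (𝓡 (n + k))
      (Remodel.toRemodel 𝓘(ℝ, 𝔼 n × 𝔼 k) (prodModelLin n k) P.Total) (P.retr (x, v))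
      (mfderiv ((𝓡 n).prod (𝓡 m)) 𝓘(ℝ, 𝔼 n × 𝔼 k) P.retr (x, v) S) = 0 :=
    hinjG (hS'.trans (ContinuousLinearMap.map_zero _).symm)
  exact hinjT (h1.trans (ContinuousLinearMap.map_zero _).symm)

/-- **Hirsch's theorem, immersion form** (Kirby, Ch. VI, Lemma 1: "`τ_M ⊕ ν` trivial `⇒` `M`
immerses with normal bundle `ν`"): if `TM ⊕ E` is framed (hypotheses as in
`isParallelizable_total_of_frame`, `k ≥ 1`), there is a `C^∞` map `F : M × ℝᵐ → ℝⁿ⁺ᵏ` such that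
`g = F(·, 0)` is a `C^∞` immersion `M ↬ ℝⁿ⁺ᵏ`, `dg_x X = dF_{(x,0)}(X, 0)`, and `dF_{(x,0)}` is
injective on `T_x M × E_x` — so `w ↦ dF_{(x,0)}(0, w)` maps `E_x` isomorphically onto a complement
of `dg_x(T_x M)`: `E` is the normal bundle of `g`. [cite: Hirsch1959, Thm. 6.3; Kirby1989, Ch. VI Lemma 1] -/
theorem exists_immersion_of_frame (hk : 1 ≤ k) {M : Type} [TopologicalSpace M] [T2Space M]
    [SecondCountableTopology M] [ChartedSpace (𝔼 n) M] [IsManifold (𝓡 n) ∞ M]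
    (P : ProjBundle n m k M) (s : Fin (n + k) → M → 𝔼 n × 𝔼 m)
    (hs1 : ∀ i, Continuous fun x => (TotalSpace.mk' (𝔼 n) x (s i x).1 : TangentBundle (𝓡 n) M))
    (hs2 : ∀ i, Continuous fun x => (s i x).2)
    (hs3 : ∀ i x, P.proj x (s i x).2 = (s i x).2)
    (hli : ∀ x, LinearIndependent ℝ fun i => s i x) :
    ∃ F : M × 𝔼 m → 𝔼 (n + k), ContMDiff ((𝓡 n).prod (𝓡 m)) (𝓡 (n + k)) ∞ F ∧
      ContMDiff (𝓡 n) (𝓡 (n + k)) ∞ (fun y => F (y, 0)) ∧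
      (∀ x, Injective (mfderiv (𝓡 n) (𝓡 (n + k)) (fun y => F (y, 0)) x)) ∧
      (∀ (x : M) (X : 𝔼 n), mfderiv (𝓡 n) (𝓡 (n + k)) (fun y => F (y, 0)) x X =
        mfderiv ((𝓡 n).prod (𝓡 m)) (𝓡 (n + k)) F (x, 0) (X, (0 : 𝔼 m))) ∧
      ∀ (x : M) (X : 𝔼 n) (w : 𝔼 m), P.proj x w = w →
        mfderiv ((𝓡 n).prod (𝓡 m)) (𝓡 (n + k)) F (x, 0) (X, w) = 0 → X = 0 ∧ w = 0 := by
  obtain ⟨F, hF, hker⟩ := P.exists_immersion_of_isParallelizable_total hk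
    (P.isParallelizable_total_of_frame s hs1 hs2 hs3 hli)
  -- `g = F ∘ (·, 0)` and `dg_x X = dF_{(x,0)} (X, 0)`
  have hι : ContMDiff (𝓡 n) ((𝓡 n).prod (𝓡 m)) ∞ fun y : M => (y, (0 : 𝔼 m)) :=
    contMDiff_id.prodMk contMDiff_const
  have hg : ContMDiff (𝓡 n) (𝓡 (n + k)) ∞ fun y => F (y, 0) := hF.comp hι
  have hdg : ∀ (x : M) (X : 𝔼 n), mfderiv (𝓡 n) (𝓡 (n + k)) (fun y => F (y, 0)) x X =
      mfderiv ((𝓡 n).prod (𝓡 m)) (𝓡 (n + k)) F (x, 0) (X, (0 : 𝔼 m)) := by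
    intro x X
    have hcomp : (fun y => F (y, 0)) = F ∘ fun y : M => (y, (0 : 𝔼 m)) := rfl
    rw [hcomp, mfderiv_comp x (g := F) (f := fun y : M => (y, (0 : 𝔼 m)))
      ((hF _).mdifferentiableAt (by simp)) ((hι x).mdifferentiableAt (by simp)), mfderiv_prod_left]
    rfl
  refine ⟨F, hF, hg, fun x => ?_, hdg, fun x X w hw h0 => ?_⟩
  · refine (injective_iff_map_eq_zero _).2 fun X hX => ?_
    rw [hdg] at hX
    exact (hker x 0 _ hX).1
  · have h := hker x 0 _ h0
    exact ⟨h.1, by rw [← hw]; exact h.2⟩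

end ProjBundle

end Literature.Topology.Immersions
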